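import Literature.NumberTheory.ConnesConsani2021.QuasiInnerArchPrimeResidues
import Literature.NumberTheory.ConnesConsani2021.QuasiInnerPrimeOffDiag
import Literature.NumberTheory.ConnesConsani2021.QuasiInnerProductArchPart
import HarnessLib

/-!
# Connes–Consani 2021 (JNT) §4.3, Theorem 4.4 (ii) PROVED — the decomposition
# `(1 − 𝒫)κκ_p𝒫 = ℰ_∞ + ℰ_p + ℰ_0`

LINE 1 — LABEL: RH-FREE corpus literature (an identity between bounded operators on `L²(S¹)` built from
the local-factor ratios `ρ_∞`, `ρ_p`; no positivity statement, no statement about zeros of `ζ`);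
bears_on: W-C/W-P (P5 sequel vocabulary, no leaf role); WHAT THIS IS NOT: any claim about RH — nothing in
this file bears on the truth of RH.

Source: A. Connes, C. Consani, *Quasi-inner functions and local factors*, J. Number Theory **226**
(2021) 139–167 = arXiv:2008.10974 [bib: `ConnesConsani2021QuasiInner`], Theorem 4.4 (ii) and its proof
(arXiv chunks p0011:L89–p0012:L35). THEOREMS ONLY (no definition, no named fact).

## The assembly (RH-FREE)

Both sides of `(1 − 𝒫)κκ_p𝒫 = ℰ_∞ + ((1−p)/p)U₋VDIV*U₊* + ℰ₀` are bounded operators; they are compared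
through their matrices in the Fourier basis (as in the landed proof of Lemma 3.5,
`QuasiInnerPrimeOffDiag.lean`): the entry `(−k−1, b)`, `b ≥ 0`, of the left side is the Fourier
coefficient `(κκ_p)^(−k−b−1)` (`inner_fourierLp_negSucc_hardyOffDiag_fourierLp_natCast`), which by the
residue computation `exists_fourierCoeff_kappaArchPrime_eq` (`QuasiInnerArchPrimeResidues.lean`; the same
display is `exists_fourierCoeff_kappaArch_mul_kappaPrime_neg` of `QuasiInnerProductResidues.lean`) is
`Σ_{n≥1} α(n)ρ_p(−2n)x(n)^{k+b} + Σ_{n≠0} ρ_∞(2πin/log p)c_n x_p(n)^{k+b} + (A + B(k+b))x₀^{k+b}`,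
`x₀ = −⅓`; the three groups are the matrix entries of `ℰ_∞ = Σ c^{(p)}_n|ξ_n⟩⟨η_n|` (norm-convergent,
`hasSum_thm44_rankOne_tsum`, `inner_fourierLp_tsum_thm44_rankOne` of `QuasiInnerProductArchPart.lean`),
of `ℰ_p` (strong expansion `hasSum_rankOne_primeModel_rhoArchDiag`), and of the rank `≤ 2` operator
`ℰ₀ = A|ξ_{x₀}⟩⟨η_{x₀}| + B(|ξ₁⟩⟨η_{x₀}| + |ξ_{x₀}⟩⟨η₁|)`, `ξ₁ = Σ_k k x₀^k e_{−k−1}`,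
`η₁ = Σ_b b x₀^b e_b` («The contribution of the terms in `αx^{k−1}` gives `α(1−𝒫)f_x𝒫` … the terms
`β(k−1)x^{k−1}` give `xβ(1−𝒫)f_x²𝒫` … Thus this contribution gives an operator of rank 2», p0012:L31–L35).

* `thm_4_4_ii_holds : thm_4_4_ii` — **Theorem 4.4 (ii) PROVED**; discharges the named fact of
  `QuasiInnerProducts.lean`.

Nothing in this file bears on the truth of RH.
-/

noncomputable section

open _root_.MeasureTheory _root_.Complex AddCircle Filter Set
open scoped Real Topology Nat InnerProductSpace ComplexConjugate ENNReal

namespace Literature.NumberTheory.ConnesConsani2021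

namespace QuasiInner

/-! ### A. Plumbing: vectors given by their Fourier expansions -/

section Plumbing

/-- RH-FREE. Two vectors of `L²(S¹)` with the same Fourier coefficients are equal. [folklore] -/
private theorem ph_eq_of_inner_fourierLp_eq {v w : Lp ℂ 2 (haarAddCircle (T := (1 : ℝ)))}
    (h : ∀ n : ℤ, ⟪fourierLp (T := 1) 2 n, v⟫_ℂ = ⟪fourierLp (T := 1) 2 n, w⟫_ℂ) : v = w := by
  apply (fourierBasis (T := 1)).repr.injective
  ext n
  have e : ∀ u : Lp ℂ 2 (haarAddCircle (T := (1 : ℝ))),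
      (fourierBasis (T := 1)).repr u n = ⟪fourierLp (T := 1) 2 n, u⟫_ℂ := fun u => by
    rw [HilbertBasis.repr_apply_apply, coe_fourierBasis]
  rw [e, e, h n]

/-- RH-FREE. Fourier coefficients only depend on the a.e. class. [folklore] -/
private theorem ph_fourierCoeff_congr_ae {f g : AddCircle (1 : ℝ) → ℂ}
    (h : f =ᵐ[haarAddCircle (T := 1)] g) (n : ℤ) :
    fourierCoeff (T := 1) f n = fourierCoeff (T := 1) g n := by
  simp only [fourierCoeff]
  exact integral_congr_ae (by filter_upwards [h] with x hx; simp only [hx])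

/-- RH-FREE. If `v = Σ_i g(i) e_{σ(i)}` along an injective family of modes, then `⟨e_{σ(i)} | v⟩ = g(i)`.
[folklore] -/
private theorem ph_inner_fourierLp_of_hasSum {ι : Type*} {σ : ι → ℤ} (hσ : Function.Injective σ)
    {g : ι → ℂ} {v : Lp ℂ 2 (haarAddCircle (T := (1 : ℝ)))}
    (h : HasSum (fun i => g i • fourierLp (T := 1) 2 (σ i)) v) (i : ι) :
    ⟪fourierLp (T := 1) 2 (σ i), v⟫_ℂ = g i := by
  classical
  have h1 := (innerSL ℂ (fourierLp (T := 1) 2 (σ i))).hasSum h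
  simp only [innerSL_apply_apply, inner_smul_right] at h1
  have hon := orthonormal_iff_ite.1 (orthonormal_fourier (T := (1 : ℝ)))
  have hterm : (fun j : ι => g j * ⟪fourierLp (T := 1) 2 (σ i), fourierLp (T := 1) 2 (σ j)⟫_ℂ) =
      fun j => if j = i then g i else 0 := by
    funext j
    rw [hon]
    by_cases hji : j = i
    · subst hji; simp
    · have : σ i ≠ σ j := fun h => hji (hσ h).symm
      rw [if_neg this, if_neg hji, mul_zero]
  rw [hterm] at h1
  exact h1.unique (hasSum_ite_eq i (g i))

/-- RH-FREE. … and `⟨e_j | v⟩ = 0` for every mode `e_j` outside the family. [folklore] -/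
private theorem ph_inner_fourierLp_of_hasSum_eq_zero {ι : Type*} {σ : ι → ℤ}
    {g : ι → ℂ} {v : Lp ℂ 2 (haarAddCircle (T := (1 : ℝ)))}
    (h : HasSum (fun i => g i • fourierLp (T := 1) 2 (σ i)) v) {j : ℤ} (hj : ∀ i, σ i ≠ j) :
    ⟪fourierLp (T := 1) 2 j, v⟫_ℂ = 0 := by
  classical
  have h1 := (innerSL ℂ (fourierLp (T := 1) 2 j)).hasSum h
  simp only [innerSL_apply_apply, inner_smul_right] at h1
  have hon := orthonormal_iff_ite.1 (orthonormal_fourier (T := (1 : ℝ)))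
  have hterm : (fun i : ι => g i * ⟪fourierLp (T := 1) 2 j, fourierLp (T := 1) 2 (σ i)⟫_ℂ) =
      fun _ => 0 := by
    funext i
    rw [hon, if_neg (fun h => hj i h.symm), mul_zero]
  rw [hterm] at h1
  exact h1.unique hasSum_zero

/-- RH-FREE. The sequence `k ↦ k x₀^k` (`|x₀| < 1`) is square summable. [folklore] -/
private theorem ph_memℓp_mul_pow {x₀ : ℂ} (hx : ‖x₀‖ < 1) : Memℓp (fun k : ℕ => (k : ℂ) * x₀ ^ k) 2 := by
  rw [memℓp_gen_iff (by norm_num)]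
  have hr : ‖(‖x₀‖ ^ 2 : ℝ)‖ < 1 := by
    rw [Real.norm_eq_abs, abs_of_nonneg (by positivity)]
    nlinarith [norm_nonneg x₀]
  have h := summable_pow_mul_geometric_of_norm_lt_one 2 hr
  refine h.congr fun k => ?_
  rw [ENNReal.toReal_ofNat, Real.rpow_two, norm_mul, norm_pow, Complex.norm_natCast]
  ring

/-- RH-FREE. Coordinates of `toL2SeqOrZero (k ↦ k x₀^k)`. [folklore] -/
private theorem ph_toL2SeqOrZero_mul_pow_apply {x₀ : ℂ} (hx : ‖x₀‖ < 1) (k : ℕ) :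
    toL2SeqOrZero (fun k : ℕ => (k : ℂ) * x₀ ^ k) k = (k : ℂ) * x₀ ^ k := by
  simp only [toL2SeqOrZero, ph_memℓp_mul_pow hx, dif_pos]

end Plumbing

/-! ### B. The matrix of `ℰ_p = ((1−p)/p)U₋VDIV*U₊*` with the printed diagonal -/

section PrimePart

/-- RH-FREE. **The matrix of `ℰ_p`**, entries `(−k−1, b)`, `b ≥ 0`:
`⟨e_{−k−1} | ℰ_p e_b⟩ = Σ_{n≠0} ρ_∞(2πin/log p) c_n x_p(n)^{k+b}` (as a `HasSum`; the strong expansion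
`hasSum_rankOne_primeModel_rhoArchDiag`, `⟨e_{−k−1}|ξ_x⟩ = x^k`, `⟨η_x|e_b⟩ = x^b`).
[cite: ConnesConsani2021QuasiInner, Thm 4.4 (ii) proof, display «uinftypoff2» (arXiv chunk p0012:L3–L18)] -/
theorem hasSum_inner_fourierLp_negSucc_primeModelDiag {p : ℕ} (hp : p.Prime)
    (V : lp (fun _ : ℤ => ℂ) 2 →L[ℂ] lp (fun _ : ℕ => ℂ) 2)
    (Iop Dop : lp (fun _ : ℤ => ℂ) 2 →L[ℂ] lp (fun _ : ℤ => ℂ) 2)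
    (hV : ∀ n : ℤ, V (lp.single 2 n (1 : ℂ)) = zetaVec p n)
    (hI : ∀ n : ℤ, Iop (lp.single 2 n (1 : ℂ)) = lp.single 2 (-n) (1 : ℂ))
    (hD0 : Dop (lp.single 2 0 (1 : ℂ)) = 0)
    (hD : ∀ n : ℤ, n ≠ 0 →
      Dop (lp.single 2 n (1 : ℂ)) = rhoArch (2 * π * I * n / Real.log p) • lp.single 2 n (1 : ℂ))
    (k b : ℕ) :
    HasSum (fun n : ℤ => if n = 0 then (0 : ℂ) else
        rhoArch (2 * π * I * n / Real.log p) *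
          (8 * (1 - (p : ℂ)⁻¹) * Real.log p / (4 * π * n + 3 * I * Real.log p) ^ 2 * xPrime p n ^ (k + b)))
      ⟪fourierLp (T := 1) 2 (-(k + 1 : ℤ)),
        ((((((1 - (p : ℝ)) / p : ℝ)) : ℂ) •
            ((hardyIsoMinus 1).toContinuousLinearMap ∘L V ∘L Dop ∘L Iop ∘L
              (ContinuousLinearMap.adjoint V) ∘L
              ContinuousLinearMap.adjoint (hardyIsoPlus 1).toContinuousLinearMap))
          (fourierLp (T := 1) 2 (b : ℤ)))⟫_ℂ := by
  have hp1 : 1 < p := hp.one_lt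
  have h := (innerSL ℂ (fourierLp (T := 1) 2 (-(k + 1 : ℤ)))).hasSum
    (hasSum_rankOne_primeModel_rhoArchDiag hp V Iop Dop hV hI hD0 hD (fourierLp (T := 1) 2 (b : ℤ)))
  simp only [innerSL_apply_apply] at h
  have hterm : (fun n : ℤ => ⟪fourierLp (T := 1) 2 (-(k + 1 : ℤ)),
      ((((if n = 0 then (0 : ℂ) else rhoArch (2 * π * I * n / Real.log p)) *
          ((8 * (1 - (p : ℂ)⁻¹) * Real.log p) / (4 * π * n + 3 * I * Real.log p) ^ 2)) •
        InnerProductSpace.rankOne ℂ (xiVec 1 (xPrime p n)) (etaVec 1 (xPrime p n)))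
        (fourierLp (T := 1) 2 (b : ℤ)))⟫_ℂ) =
      fun n : ℤ => (if n = 0 then (0 : ℂ) else rhoArch (2 * π * I * n / Real.log p) *
        (8 * (1 - (p : ℂ)⁻¹) * Real.log p / (4 * π * n + 3 * I * Real.log p) ^ 2 * xPrime p n ^ (k + b))) := by
    funext n
    have hx : ‖xPrime p n‖ < 1 := norm_xPrime_lt_one hp1 n
    rw [FunLike.coe_smul, Pi.smul_apply, InnerProductSpace.rankOne_apply, inner_smul_right, inner_smul_right,
      inner_fourierLp_negSucc_xiVec 1 _ hx k, ← inner_conj_symm, inner_fourierLp_natCast_etaVec _ hx b,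
      map_pow, Complex.conj_conj]
    split_ifs with hn
    · simp
    · rw [pow_add]; ring
  rw [hterm] at h
  exact h

/-- RH-FREE. `ℰ_p` has no entries in non-negative rows: `⟨e_a | ℰ_p v⟩ = 0`, `a ≥ 0` (`⟨e_a|ξ_x⟩ = 0`).
[cite: ConnesConsani2021QuasiInner, Thm 4.4 (ii) proof (arXiv chunk p0012:L3–L18) with Lemma 2.2 (p0006:L30–L41)] -/
theorem inner_fourierLp_natCast_primeModelDiag {p : ℕ} (hp : p.Prime)
    (V : lp (fun _ : ℤ => ℂ) 2 →L[ℂ] lp (fun _ : ℕ => ℂ) 2)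
    (Iop Dop : lp (fun _ : ℤ => ℂ) 2 →L[ℂ] lp (fun _ : ℤ => ℂ) 2)
    (hV : ∀ n : ℤ, V (lp.single 2 n (1 : ℂ)) = zetaVec p n)
    (hI : ∀ n : ℤ, Iop (lp.single 2 n (1 : ℂ)) = lp.single 2 (-n) (1 : ℂ))
    (hD0 : Dop (lp.single 2 0 (1 : ℂ)) = 0)
    (hD : ∀ n : ℤ, n ≠ 0 →
      Dop (lp.single 2 n (1 : ℂ)) = rhoArch (2 * π * I * n / Real.log p) • lp.single 2 n (1 : ℂ))
    (a : ℕ) (b : ℤ) :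
    ⟪fourierLp (T := 1) 2 (a : ℤ),
      ((((((1 - (p : ℝ)) / p : ℝ)) : ℂ) •
          ((hardyIsoMinus 1).toContinuousLinearMap ∘L V ∘L Dop ∘L Iop ∘L
            (ContinuousLinearMap.adjoint V) ∘L
            ContinuousLinearMap.adjoint (hardyIsoPlus 1).toContinuousLinearMap))
        (fourierLp (T := 1) 2 b))⟫_ℂ = 0 := by
  have hp1 : 1 < p := hp.one_lt
  have h := (innerSL ℂ (fourierLp (T := 1) 2 (a : ℤ))).hasSum
    (hasSum_rankOne_primeModel_rhoArchDiag hp V Iop Dop hV hI hD0 hD (fourierLp (T := 1) 2 b))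
  simp only [innerSL_apply_apply] at h
  have hterm : (fun n : ℤ => ⟪fourierLp (T := 1) 2 (a : ℤ),
      ((((if n = 0 then (0 : ℂ) else rhoArch (2 * π * I * n / Real.log p)) *
          ((8 * (1 - (p : ℂ)⁻¹) * Real.log p) / (4 * π * n + 3 * I * Real.log p) ^ 2)) •
        InnerProductSpace.rankOne ℂ (xiVec 1 (xPrime p n)) (etaVec 1 (xPrime p n)))
        (fourierLp (T := 1) 2 b))⟫_ℂ) = fun _ : ℤ => 0 := by
    funext n
    have hx : ‖xPrime p n‖ < 1 := norm_xPrime_lt_one hp1 n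
    rw [FunLike.coe_smul, Pi.smul_apply, InnerProductSpace.rankOne_apply, inner_smul_right, inner_smul_right,
      inner_fourierLp_natCast_xiVec 1 _ hx a, mul_zero, mul_zero]
  rw [hterm] at h
  exact h.unique hasSum_zero

/-- RH-FREE. `ℰ_p` kills the negative modes: `ℰ_p e_{−m−1} = 0` (`⟨η_x|e_{−m−1}⟩ = 0`).
[cite: ConnesConsani2021QuasiInner, Thm 4.4 (ii) proof (arXiv chunk p0012:L3–L18) with Lemma 2.2 (p0006:L41)] -/
theorem primeModelDiag_fourierLp_negSucc {p : ℕ} (hp : p.Prime)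
    (V : lp (fun _ : ℤ => ℂ) 2 →L[ℂ] lp (fun _ : ℕ => ℂ) 2)
    (Iop Dop : lp (fun _ : ℤ => ℂ) 2 →L[ℂ] lp (fun _ : ℤ => ℂ) 2)
    (hV : ∀ n : ℤ, V (lp.single 2 n (1 : ℂ)) = zetaVec p n)
    (hI : ∀ n : ℤ, Iop (lp.single 2 n (1 : ℂ)) = lp.single 2 (-n) (1 : ℂ))
    (hD0 : Dop (lp.single 2 0 (1 : ℂ)) = 0)
    (hD : ∀ n : ℤ, n ≠ 0 →
      Dop (lp.single 2 n (1 : ℂ)) = rhoArch (2 * π * I * n / Real.log p) • lp.single 2 n (1 : ℂ))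
    (m : ℕ) :
    ((((((1 - (p : ℝ)) / p : ℝ)) : ℂ) •
          ((hardyIsoMinus 1).toContinuousLinearMap ∘L V ∘L Dop ∘L Iop ∘L
            (ContinuousLinearMap.adjoint V) ∘L
            ContinuousLinearMap.adjoint (hardyIsoPlus 1).toContinuousLinearMap))
        (fourierLp (T := 1) 2 (-(m + 1 : ℤ)))) = 0 := by
  have hp1 : 1 < p := hp.one_lt
  have h := hasSum_rankOne_primeModel_rhoArchDiag hp V Iop Dop hV hI hD0 hD (fourierLp (T := 1) 2 (-(m + 1 : ℤ)))
  have hterm : (fun n : ℤ =>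
      ((((if n = 0 then (0 : ℂ) else rhoArch (2 * π * I * n / Real.log p)) *
          ((8 * (1 - (p : ℂ)⁻¹) * Real.log p) / (4 * π * n + 3 * I * Real.log p) ^ 2)) •
        InnerProductSpace.rankOne ℂ (xiVec 1 (xPrime p n)) (etaVec 1 (xPrime p n)))
        (fourierLp (T := 1) 2 (-(m + 1 : ℤ))))) = fun _ : ℤ => 0 := by
    funext n
    have hx : ‖xPrime p n‖ < 1 := norm_xPrime_lt_one hp1 n
    rw [FunLike.coe_smul, Pi.smul_apply, InnerProductSpace.rankOne_apply, ← inner_conj_symm,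
      inner_fourierLp_negSucc_etaVec _ hx m, map_zero, zero_smul, smul_zero]
  rw [hterm] at h
  exact h.unique hasSum_zero

end PrimePart

/-! ### C. The boundary function of `κκ_p` -/

section Symbol

/-- RH-FREE. The boundary function `κκ_p|S¹` is in `L^∞(S¹)` (measurable, `|κκ_p| = 1`); its `L^∞` class is
a.e. the function (also `memLp_circleRestrict_kappaArch_mul_kappaPrime` of `QuasiInnerProductSymbol.lean`,
seat t5; private copy to keep the import light). [folklore] -/
private theorem ph_memLp_kappaProduct {p : ℕ} (hp : 1 < p) :
    MemLp (circleRestrict 1 fun v => kappaArch v * kappaPrime p v) ∞ (haarAddCircle (T := 1)) ∧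
      ((toLpOrZero ∞ haarAddCircle (circleRestrict 1 fun v => kappaArch v * kappaPrime p v) :
          Lp ℂ ∞ (haarAddCircle (T := 1))) : AddCircle (1 : ℝ) → ℂ) =ᵐ[haarAddCircle (T := 1)]
        circleRestrict 1 fun v => kappaArch v * kappaPrime p v := by
  obtain ⟨h1, -, -⟩ := memLp_circleRestrict_kappaArch
  obtain ⟨h2, -, -⟩ := memLp_circleRestrict_kappaPrime hp
  have heq : (circleRestrict 1 fun v => kappaArch v * kappaPrime p v) =
      fun x => circleRestrict 1 kappaArch x * circleRestrict 1 (kappaPrime p) x := rfl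
  have hmem : MemLp (circleRestrict 1 fun v => kappaArch v * kappaPrime p v) ∞ (haarAddCircle (T := 1)) := by
    rw [heq]
    refine memLp_top_of_bound (h1.aestronglyMeasurable.mul h2.aestronglyMeasurable) 1
      (ae_of_all _ fun x => ?_)
    rw [norm_mul, norm_circleRestrict_kappaArch 1 x, norm_circleRestrict_kappaPrime (T := 1) hp x, mul_one]
  refine ⟨hmem, ?_⟩
  rw [toLpOrZero_eq_toLp hmem]
  exact hmem.coeFn_toLp

end Symbol

/-! ### D. Theorem 4.4 (ii) -/

section TheoremFourFour

/-- RH-FREE. **Theorem 4.4 (ii) PROVED**: «The off diagonal part for the function `ρ_∞(z)ρ_p(z)` is the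
infinitesimal in `L²(S¹)` which is the sum of three terms `(1 − 𝒫)κκ_p𝒫 = ℰ_∞ + ℰ_p + ℰ_0` where
`ℰ_∞ = Σ_{n≥1} (−1)^n 2π^{2n+½}(1 − p^{−(2n+1)})((4n+1)(p^{2n}−1)Γ(n+1)Γ(n+½))^{−1}|ξ_n⟩⟨η_n|`,
`ℰ_p = ((1−p)/p)U₋VDIV*U₊*`, `Dδ_0 = 0`, `Dδ_n = ρ_∞(2πin/log p)δ_n` (`n ≠ 0`). Moreover `ℰ_0` is an
operator of finite rank.» — for ANY bounded `V`, `I`, `D` with the printed actions on the basis `δ_n`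
(as typed). Assembly by matrix comparison in the Fourier basis (module docstring). Discharges the named
fact `thm_4_4_ii` of `QuasiInnerProducts.lean`.
[cite: ConnesConsani2021QuasiInner, Thm 4.4 (ii) eqs. (4.3)–(4.4) (arXiv chunk p0011:L89–L100; proof p0011:L102–p0012:L35)] -/
theorem thm_4_4_ii_holds : QuasiInner.thm_4_4_ii := by
  intro p hp V Iop Dop hV hI hD0 hD
  have hp1 : 1 < p := hp.one_lt
  -- the symbol and its Fourier coefficients
  obtain ⟨-, hae⟩ := ph_memLp_kappaProduct hp1
  obtain ⟨A, B, hcoef⟩ := exists_fourierCoeff_kappaArchPrime_eq hp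
  -- `ℰ_∞`
  obtain ⟨Einf, hEsum⟩ : ∃ E : Lp ℂ 2 (haarAddCircle (T := 1)) →L[ℂ] Lp ℂ 2 (haarAddCircle (T := 1)),
      HasSum (fun n : ℕ => (thm44Coeff p (n + 1) : ℂ) •
        InnerProductSpace.rankOne ℂ
          ((‖xiVec 1 (xArch (n + 1) : ℂ)‖⁻¹ : ℂ) • xiVec 1 (xArch (n + 1) : ℂ))
          ((‖etaVec 1 (xArch (n + 1) : ℂ)‖⁻¹ : ℂ) • etaVec 1 (xArch (n + 1) : ℂ))) E :=
    ⟨_, hasSum_thm44_rankOne_tsum hp⟩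
  obtain ⟨hEmat, hErow, hEcol⟩ := inner_fourierLp_tsum_thm44_rankOne hp hEsum
  -- the rank-two operator `ℰ₀`
  have hx : ‖(-1 / 3 : ℂ)‖ < 1 := by norm_num
  have hxr : conj (-1 / 3 : ℂ) = (-1 / 3 : ℂ) := by
    rw [show (-1 / 3 : ℂ) = ((-1 / 3 : ℝ) : ℂ) by push_cast; ring, conj_ofReal]
  have hg₁k : ∀ k : ℕ, toL2SeqOrZero (fun k : ℕ => (k : ℂ) * (-1 / 3 : ℂ) ^ k) k = (k : ℂ) * (-1 / 3 : ℂ) ^ k :=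
    fun k => ph_toL2SeqOrZero_mul_pow_apply hx k
  obtain ⟨ξ₀, hξ₀⟩ : ∃ v : Lp ℂ 2 (haarAddCircle (T := 1)), v = xiVec 1 (-1 / 3 : ℂ) := ⟨_, rfl⟩
  obtain ⟨η₀, hη₀⟩ : ∃ v : Lp ℂ 2 (haarAddCircle (T := 1)), v = etaVec 1 (-1 / 3 : ℂ) := ⟨_, rfl⟩
  obtain ⟨ξ₁, hξ₁⟩ : ∃ v : Lp ℂ 2 (haarAddCircle (T := 1)),
      v = hardyIsoMinus 1 (toL2SeqOrZero (fun k : ℕ => (k : ℂ) * (-1 / 3 : ℂ) ^ k)) := ⟨_, rfl⟩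
  obtain ⟨η₁, hη₁⟩ : ∃ v : Lp ℂ 2 (haarAddCircle (T := 1)),
      v = hardyIsoPlus 1 (toL2SeqOrZero (fun k : ℕ => (k : ℂ) * (-1 / 3 : ℂ) ^ k)) := ⟨_, rfl⟩
  have hξ₁sum : HasSum (fun k : ℕ => ((k : ℂ) * (-1 / 3 : ℂ) ^ k) • fourierLp (T := 1) 2 (-(k + 1 : ℤ))) ξ₁ := by
    have h := hasSum_hardyIsoMinus 1 (toL2SeqOrZero (fun k : ℕ => (k : ℂ) * (-1 / 3 : ℂ) ^ k))
    simp only [hg₁k] at h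
    rw [hξ₁]
    exact h
  have hη₁sum : HasSum (fun k : ℕ => ((k : ℂ) * (-1 / 3 : ℂ) ^ k) • fourierLp (T := 1) 2 (k : ℤ)) η₁ := by
    have h := hasSum_hardyIsoPlus 1 (toL2SeqOrZero (fun k : ℕ => (k : ℂ) * (-1 / 3 : ℂ) ^ k))
    simp only [hg₁k] at h
    rw [hη₁]
    exact h
  have hσm : Function.Injective fun k : ℕ => (-(k + 1 : ℤ)) := fun a b h => by
    have : (a : ℤ) = b := by
      simp only [neg_inj] at h
      linarith
    exact_mod_cast this
  have hσp : Function.Injective fun k : ℕ => (k : ℤ) := fun a b h => by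
    have h' : (a : ℤ) = b := h
    exact_mod_cast h'
  -- entries of the four vectors
  have hξ₀neg : ∀ k : ℕ, ⟪fourierLp (T := 1) 2 (-(k + 1 : ℤ)), ξ₀⟫_ℂ = (-1 / 3 : ℂ) ^ k := fun k => by
    rw [hξ₀]; exact inner_fourierLp_negSucc_xiVec 1 _ hx k
  have hξ₀pos : ∀ a : ℕ, ⟪fourierLp (T := 1) 2 (a : ℤ), ξ₀⟫_ℂ = 0 := fun a => by
    rw [hξ₀]; exact inner_fourierLp_natCast_xiVec 1 _ hx a
  have hη₀pos : ∀ b : ℕ, ⟪η₀, fourierLp (T := 1) 2 (b : ℤ)⟫_ℂ = (-1 / 3 : ℂ) ^ b := by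
    intro b
    rw [hη₀, ← inner_conj_symm, inner_fourierLp_natCast_etaVec _ hx b, map_pow, Complex.conj_conj]
  have hη₀neg : ∀ m : ℕ, ⟪η₀, fourierLp (T := 1) 2 (-(m + 1 : ℤ))⟫_ℂ = 0 := by
    intro m
    rw [hη₀, ← inner_conj_symm, inner_fourierLp_negSucc_etaVec _ hx m, map_zero]
  have hξ₁neg : ∀ k : ℕ, ⟪fourierLp (T := 1) 2 (-(k + 1 : ℤ)), ξ₁⟫_ℂ = (k : ℂ) * (-1 / 3 : ℂ) ^ k :=
    fun k => ph_inner_fourierLp_of_hasSum hσm hξ₁sum k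
  have hξ₁pos : ∀ a : ℕ, ⟪fourierLp (T := 1) 2 (a : ℤ), ξ₁⟫_ℂ = 0 := fun a =>
    ph_inner_fourierLp_of_hasSum_eq_zero hξ₁sum fun k => by
      show (-(k + 1 : ℤ)) ≠ (a : ℤ); omega
  have hη₁pos : ∀ b : ℕ, ⟪η₁, fourierLp (T := 1) 2 (b : ℤ)⟫_ℂ = (b : ℂ) * (-1 / 3 : ℂ) ^ b := by
    intro b
    rw [← inner_conj_symm, ph_inner_fourierLp_of_hasSum hσp hη₁sum b, map_mul, map_pow, hxr,
      Complex.conj_natCast]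
  have hη₁neg : ∀ m : ℕ, ⟪η₁, fourierLp (T := 1) 2 (-(m + 1 : ℤ))⟫_ℂ = 0 := by
    intro m
    rw [← inner_conj_symm, ph_inner_fourierLp_of_hasSum_eq_zero hη₁sum (fun k => by
      show ((k : ℕ) : ℤ) ≠ -(m + 1 : ℤ); omega), map_zero]
  obtain ⟨E0, hE0⟩ : ∃ E : Lp ℂ 2 (haarAddCircle (T := 1)) →L[ℂ] Lp ℂ 2 (haarAddCircle (T := 1)),
      E = A • InnerProductSpace.rankOne ℂ ξ₀ η₀ +
        B • (InnerProductSpace.rankOne ℂ ξ₁ η₀ + InnerProductSpace.rankOne ℂ ξ₀ η₁) := ⟨_, rfl⟩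
  have hE0apply : ∀ v, E0 v = (A * ⟪η₀, v⟫_ℂ + B * ⟪η₁, v⟫_ℂ) • ξ₀ + (B * ⟪η₀, v⟫_ℂ) • ξ₁ := by
    intro v
    rw [hE0]
    simp only [_root_.add_apply, FunLike.coe_smul, Pi.smul_apply,
      InnerProductSpace.rankOne_apply, smul_add, smul_smul, add_smul]
    abel
  refine ⟨Einf, E0, hEsum, ?_, ?_⟩
  · -- `ℰ₀` has finite rank: its range lies in the span of `ξ₀, ξ₁`
    have hle : LinearMap.range E0.toLinearMap ≤ Submodule.span ℂ ({ξ₀, ξ₁} : Set _) := by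
      rintro _ ⟨v, rfl⟩
      rw [ContinuousLinearMap.coe_coe, hE0apply]
      exact Submodule.add_mem _ (Submodule.smul_mem _ _ (Submodule.subset_span (by simp)))
        (Submodule.smul_mem _ _ (Submodule.subset_span (by simp)))
    haveI : FiniteDimensional ℂ (Submodule.span ℂ ({ξ₀, ξ₁} : Set (Lp ℂ 2 (haarAddCircle (T := (1 : ℝ)))))) :=
      FiniteDimensional.span_of_finite ℂ (Set.toFinite _)
    exact Submodule.finiteDimensional_of_le hle
  · -- the matrix comparison
    have hdense : Dense (Submodule.span ℂ (Set.range (fourierLp (T := 1) 2)) :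
        Set (Lp ℂ 2 (haarAddCircle (T := 1)))) :=
      Submodule.dense_iff_topologicalClosure_eq_top.2 (span_fourierLp_closure_eq_top (by norm_num))
    refine ContinuousLinearMap.ext_on hdense ?_
    rintro _ ⟨m, rfl⟩
    rw [_root_.add_apply, _root_.add_apply]
    rcases m with b | m
    · -- column `b ≥ 0`
      rw [Int.ofNat_eq_natCast]
      refine ph_eq_of_inner_fourierLp_eq fun a => ?_
      rw [inner_add_right, inner_add_right]
      rcases a with a | k
      · -- row `a ≥ 0`: everything vanishes
        rw [Int.ofNat_eq_natCast, inner_fourierLp_natCast_hardyOffDiag, hErow,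
          inner_fourierLp_natCast_primeModelDiag hp V Iop Dop hV hI hD0 hD, hE0apply, inner_add_right,
          inner_smul_right, inner_smul_right, hξ₀pos, hξ₁pos]
        ring
      · -- row `−k−1`: the Fourier coefficient `(κκ_p)^(−k−b−1)`
        rw [Int.negSucc_eq, inner_fourierLp_negSucc_hardyOffDiag_fourierLp_natCast,
          ph_fourierCoeff_congr_ae hae, ← (hEmat k b).tsum_eq,
          ← (hasSum_inner_fourierLp_negSucc_primeModelDiag hp V Iop Dop hV hI hD0 hD k b).tsum_eq,
          hE0apply, inner_add_right, inner_smul_right, inner_smul_right, hξ₀neg, hξ₁neg, hη₀pos, hη₁pos]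
        have hc := hcoef (k + b)
        rw [show ((k + b + 1 : ℕ) : ℤ) = ((k + b : ℕ) : ℤ) + 1 by push_cast; ring] at hc
        rw [hc]
        have e1 : (∑' j : ℕ, (alphaArch (j + 1) : ℂ) * rhoPrime p (-(2 * ((j + 1 : ℕ) : ℂ))) *
            (xArch (j + 1) : ℂ) ^ (k + b)) = ∑' j : ℕ, rhoPrime p (-(2 * ((j + 1 : ℕ) : ℂ))) *
            ((alphaArch (j + 1) : ℂ) * (xArch (j + 1) : ℂ) ^ (k + b)) :=
          tsum_congr fun j => by ring
        rw [e1]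
        push_cast
        ring
    · -- column `−m−1`: both sides vanish
      rw [Int.negSucc_eq, hardyOffDiag_fourierLp_negSucc, hEcol,
        primeModelDiag_fourierLp_negSucc hp V Iop Dop hV hI hD0 hD, hE0apply, hη₀neg, hη₁neg]
      simp

end TheoremFourFour

end QuasiInner

end Literature.NumberTheory.ConnesConsani2021
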